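/-
Origin: expansion seat `planner-pub-hodgecm-pv01-0`, handover 2026-08-18T03:30:56Z (`HOME/pub-hodgecm-pv01/lean/Pv01/LineFieldRigidity.lean`, md5 0c307a5b, 168 lines);
landed by the gen-5 packager in gate run 18 as `HodgeCM/PerL34/LineFieldRigidity.lean` (verbatim).
-/
/-
Copyright: pub-hodgecm cell, seat pub-hodgecm-pv01 (DAG-node prover #01).  Pure Mathlib; no cited facts.
-/
import Mathlib
import Literature.Topology.Algebra.DenseSubgroupEquivariance

/-!
# Line-field rigidity (the topological core of PerL v5 Prop. 4.3, tex ll. 664–682)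

PerL v5 (`inputs/2001/…paper-v5-d912a121.tex`) Prop. 4.3 (`prop:S12`, ll. 639–684) ends with the following
argument (ll. 664–682, quoted): *"… forming a holomorphic line sub-bundle `ℓ` of `Ω¹|_Ω` …, and `γ^*𝒰₂ = 𝒰₂` gives
`γΩ = Ω` and `ℓ_{γx} = γ_*ℓ_x` for `γ` in the image `Δ ⊂ U(2,1)` of `G_U(L₀)`.  By real approximation … `Δ` is dense
in `U(2,1)`.  Fix `x₀ ∈ Ω` and let `g ∈ U(2,1)` be any element with `gx₀ ∈ Ω`; choose `γ_n ∈ Δ`, `γ_n → g`; then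
… by continuity of `ℓ` on the open set `Ω`, `ℓ_{gx₀} = lim ℓ_{γ_n x₀} = lim (γ_n)_* ℓ_{x₀} = g_* ℓ_{x₀}` (limits in the
projectivised cotangent bundle, which is Hausdorff; the action of `U(2,1)` on it is continuous).  Every `k` in the
isotropy group `K_{x₀}` … has `kx₀ = x₀ ∈ Ω`, so `k_*ℓ_{x₀} = ℓ_{x₀}`: the line `ℓ_{x₀}` … is `K_{x₀}`-invariant.  But
… `SU(2)` is transitive on the lines of `ℂ²`: contradiction."*

This file machine-checks that argument in the natural generality, with NO analytic or automorphic input: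

* `G` a topological group acting continuously on a space `X` (the ball `𝔹²`) and on a Hausdorff space `E` (the
  projectivised cotangent bundle, or any `G`-space receiving the line field);
* `Δ ≤ G` a subgroup that is dense in `G` (real approximation, cited downstream — NOT assumed here beyond `Dense`);
* `Ω ⊆ X` open, `ℓ : X → E` continuous on `Ω` and `Δ`-equivariant on `Ω` (only where `x, γ • x ∈ Ω`; `Δ`-stability of
  `Ω` is therefore not even needed).

Conclusions: `ℓ` is `G`-equivariant at every `x₀ ∈ Ω` and every `g` with `g • x₀ ∈ Ω`
(`LineField.smul_eq_of_dense`), hence fixed by the whole isotropy group of `x₀` (`LineField.stabilizer_smul_eq`),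
and therefore no such line field exists as soon as every point of the fibre over `x₀` is moved by some element of
the isotropy group (`LineField.false_of_isotropy_moves`) — the last hypothesis is where "`SU(2)` is transitive on the
lines of `ℂ²`" is plugged in by the caller.  Sequences are replaced by the closure argument
(`Set.EqOn.of_subset_closure`), so no first-countability is needed.
-/

set_option autoImplicit false

namespace HodgeCM
namespace PerL34
namespace LineField

open Set Topology

variable {G X E : Type*} [TopologicalSpace G] [Group G]
  [TopologicalSpace X] [MulAction G X] [ContinuousSMul G X]
  [TopologicalSpace E] [MulAction G E] [ContinuousSMul G E] [T2Space E]

/-- **Equivariance extends from a dense subgroup** (PerL v5 Prop. 4.3, ll. 671–677).  If `ℓ` is continuous on the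
open set `Ω` and `Δ`-equivariant there (at pairs `x, γ • x ∈ Ω`), and `Δ` is dense in `G`, then `ℓ (g • x₀) = g • ℓ x₀` for every
`x₀ ∈ Ω` and every `g : G` with `g • x₀ ∈ Ω`. -/
alias smul_eq_of_dense := Literature.Topology.Algebra.DenseSubgroup.smul_eq_of_dense

/-- **Isotropy invariance** (PerL v5 Prop. 4.3, ll. 677–679): under the hypotheses of `smul_eq_of_dense`, every
element of the isotropy group of `x₀ ∈ Ω` fixes `ℓ x₀`. -/
alias stabilizer_smul_eq := Literature.Topology.Algebra.DenseSubgroup.stabilizer_smul_eq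

/-- The same, phrased with Mathlib's `MulAction.stabilizer`. -/
alias stabilizer_le_stabilizer := Literature.Topology.Algebra.DenseSubgroup.stabilizer_le_stabilizer

/-- **No invariant line ⇒ no line field** (PerL v5 Prop. 4.3, ll. 679–682): if every point `e` of `E` lying over
`x₀` (membership in the fibre is the caller's predicate `F`) is moved by some element of the isotropy group of `x₀`,
then a `Δ`-equivariant line field continuous on an open `Ω ∋ x₀` with `ℓ x₀` in the fibre cannot exist. -/
alias false_of_isotropy_moves := Literature.Topology.Algebra.DenseSubgroup.false_of_isotropy_moves

/-! ### The common open set (PerL v5 Prop. 4.3, ll. 664–666) and the pointwise line (ll. 661–666)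

Two more model-free bricks of the same proof: (1) a dense subgroup has dense orbits as soon as the orbit map of
the ambient group is onto (used with "`U(2,1)` is transitive on `𝔹²`"), so a `Δ`-stable non-empty open set meets
every non-empty open set; (2) the pointwise linear algebra turning "all wedges vanish" into a well-defined line. -/

omit [TopologicalSpace E] [MulAction G E] [ContinuousSMul G E] [T2Space E] in
/-- A dense subgroup `Δ` of `G` has dense orbits wherever `G` acts with surjective orbit map (`g ↦ g • x` onto). -/
alias dense_orbit_of_dense := Literature.Topology.Algebra.DenseSubgroup.dense_orbit_of_dense

omit [TopologicalSpace E] [MulAction G E] [ContinuousSMul G E] [T2Space E] in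
/-- If `Ω₁` is `Δ`-stable and non-empty, `Ω₂` is open and non-empty, and `Δ`-orbits are dense, then `Ω₁ ∩ Ω₂ ≠ ∅`
(PerL l. 664: the open set where both evaluation images are non-zero is non-empty). -/
alias inter_nonempty_of_stable := Literature.Topology.Algebra.DenseSubgroup.inter_nonempty_of_stable

/-- Pointwise linear algebra of "`u₁ ∧ u₂ = 0`": two non-zero vectors that are NOT linearly independent span the same
line.  (Over any division ring; in PerL `K = ℂ`, the vectors are the values `u₁(x), u₂(x) ∈ T^*_x 𝔹² ≅ ℂ²`.) -/
theorem span_eq_of_not_linearIndependent {K W : Type*} [DivisionRing K] [AddCommGroup W] [Module K W]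
    {a b : W} (hab : ¬ LinearIndependent K ![a, b]) (ha : a ≠ 0) (hb : b ≠ 0) :
    (K ∙ a) = (K ∙ b) := by
  rw [LinearIndependent.pair_iff] at hab
  push Not at hab
  obtain ⟨s, t, hst, hst0⟩ := hab
  -- `s • a + t • b = 0` with `(s, t) ≠ (0, 0)`; both are non-zero since `a, b ≠ 0`.
  have hs : s ≠ 0 := by
    intro hs
    apply hst0 hs
    rw [hs, zero_smul, zero_add] at hst
    exact (smul_eq_zero.mp hst).resolve_right hb
  have ht : t ≠ 0 := by
    intro ht'
    rw [ht', zero_smul, add_zero] at hst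
    exact hs ((smul_eq_zero.mp hst).resolve_right ha)
  have hb' : b = (-(t⁻¹ * s)) • a := by
    have : t • b = -(s • a) := eq_neg_of_add_eq_zero_right hst
    calc b = t⁻¹ • (t • b) := by rw [smul_smul, inv_mul_cancel₀ ht, one_smul]
      _ = (-(t⁻¹ * s)) • a := by rw [this, smul_neg, smul_smul, neg_smul]
  have ha' : a = (-(s⁻¹ * t)) • b := by
    have : s • a = -(t • b) := eq_neg_of_add_eq_zero_left hst
    calc a = s⁻¹ • (s • a) := by rw [smul_smul, inv_mul_cancel₀ hs, one_smul]
      _ = (-(s⁻¹ * t)) • b := by rw [this, smul_neg, smul_smul, neg_smul]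
  apply le_antisymm
  · rw [Submodule.span_singleton_le_iff_mem, ha']
    exact Submodule.smul_mem _ _ (Submodule.mem_span_singleton_self b)
  · rw [Submodule.span_singleton_le_iff_mem, hb']
    exact Submodule.smul_mem _ _ (Submodule.mem_span_singleton_self a)

/-- … and a vector not linearly independent from a non-zero `a` lies on the line of `a`. -/
theorem mem_span_of_not_linearIndependent {K W : Type*} [DivisionRing K] [AddCommGroup W] [Module K W]
    {a b : W} (hab : ¬ LinearIndependent K ![a, b]) (ha : a ≠ 0) : b ∈ (K ∙ a) := by
  by_cases hb : b = 0
  · rw [hb]; exact Submodule.zero_mem _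
  · rw [span_eq_of_not_linearIndependent hab ha hb]; exact Submodule.mem_span_singleton_self b

end LineField
end PerL34
end HodgeCM
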